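import Summits.Ventures.CertifiedManyBodySolver.Observables.StiffnessApexTransportCurtainTopTargetSlot
import HarnessLib

/-!
# Ventures/CertifiedManyBodySolver — Observables/StiffnessApexTransportCurtainTopShadowTargetSlot.lean

HONEST FRAMING: one-sided certified CEILINGS on the uniform flux stiffness (`t–t′` f-sum class) at ANY density, transported into the part of a `(t′, U)` box
that lies LEFT of the station's apex curve (the «TransportFan» shadow), each source read at the TARGET's own hopping slot — NO `K₂` input, no lever; a
ceiling never speaks to the presence of order; not a `T_c` estimate, not a superconductivity verdict; every leaf is CONDITIONAL on the families it names.
Zero compute, no definition, no `sorry`.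

Cell `pub/hubbard-downfold` (D-0154 (1)(C) COVERAGE, La214 M2(c) «LSCO x = 1/8» depth), seat `hubbard-cov-la214-unc-2` (`prover-hubbard-cov-la214-unc-2-0`).
The any-density edition of `Observables/StiffnessApexTransportCurtainTopShadow.lean` (this seat, half filling) on the target-slot engine
(`ObsStiffnessSeqCeilingAt_of_apexSource_targetSlot_orbitLower`, seat hubbard-downfold-unc-2 g15): for a crux of the shape «every box target whose station
source `t′(2U − U_A)/U` is `≤ p` carries the ceiling» (the K2 «TransportFanCeiling» split of route CovLa214M2b, expected again for the doped box), the lower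
left-edge window, the SHORT overhang at its top and the upper left-edge window word the whole shadow WITHOUT any bottom family — and, at `n ≠ 1`, without
any lever, because every family is read at the target slot `σ` (two end-objective reads per vertex give every `σ ∈ [p, q]`).

* `ObsStiffnessSeqCeilingAt_transportShadow_of_twoWindowCurtain_targetSlot` — LEFT₁ `{p} × [U_A, U_L₁]` + OVERHANG at `U_L₁` on `[p(2 − U_L₁/U_L₂), p]` +
  LEFT₂ `{p} × [U_L₂, U_max]` (target-slot families, `−val ≤ c`, `0 ≤ n < 2`) ⇒ `ObsStiffnessSeqCeilingAt t′ U n c` at every box target with `t′(2U − U_A)/U ≤ p`;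
* `ObsStiffnessSeqCeilingAt_transportShadow_of_shortOverhang_and_leftEdgeTop_targetSlot` — (E6)'s shadow: SHORT overhang at the station + LEFT-TOP only;
* «La214-E» doped instances on the M2(c) cell `n ∈ [171/200, 179/200]` (box `boxLa214E_M15v115`): any window height `U_L`, and `U_L = 8`.

References: T. Koma, H. Tasaki, J. Stat. Phys. 76 (1994) 745, §1 [KomaTasaki1994]; D. J. Scalapino, S. R. White, S.-C. Zhang, PRB 47 (1993)
7995, §II [ScalapinoWhiteZhang1993].
-/

noncomputable section

namespace Summit.Ventures.CertifiedManyBodySolver.Observables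

open Literature.MathematicalPhysics.QuantumLattice
open Literature.MathematicalPhysics.QuantumLattice.ThermodynamicLimit
open Literature.MathematicalPhysics.QuantumFieldTheory
open Literature.Probability.LatticeModels
open Matrix Finset Filter Topology HubbardWave0
open scoped Matrix BigOperators ComplexOrder

section Shadow

variable {UA UL₁ UL₂ Umax p q n : ℝ}

/-- **Transport-fan shadow of the two-window TARGET-SLOT curtain (any density, no `K₂` input).** Box `[p, q] × [U_A, U_max]`, `q ≤ 0 < U_A ≤ U_L₁ ≤ U_L₂`,
`0 ≤ n < 2`. WITHOUT any bottom family: the LEFT₁ target-slot family `valL₁ σ U'` (classes at `(p, U')`, `U' ∈ [U_A, U_L₁]`), the OVERHANG family `valO σ s`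
(classes at `(s, U_L₁)`, `s ∈ [p(2 − U_L₁/U_L₂), p]`) and the LEFT₂ family `valL₂ σ U'` (`U' ∈ [U_L₂, U_max]`), all for `−X₀(σ, ·)` at the target slot
`σ ∈ [p, q]` with `−val ≤ c`, give `ObsStiffnessSeqCeilingAt t′ U n c` at every box target with `t′(2U − U_A)/U ≤ p`. Routing as in the half-filling shadow
(`…CurtainTopShadow`), every source read at `σ = t′`. [cite: KomaTasaki1994, §1] [cite: ScalapinoWhiteZhang1993, §II] -/
theorem ObsStiffnessSeqCeilingAt_transportShadow_of_twoWindowCurtain_targetSlot (hUA : 0 < UA) (hA1 : UA ≤ UL₁) (h12 : UL₁ ≤ UL₂)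
    (hq : q ≤ 0) (hn0 : 0 ≤ n) (hn2 : n < 2) (valL₁ valO valL₂ : ℝ → ℝ → ℝ) (c : ℚ)
    (hL₁ : ∀ σ ∈ Set.Icc p q, ∀ U' ∈ Set.Icc UA UL₁,
      ∀ (ω : InfVolFermionState 2) (Ls : ℕ → ℕ) (ψ : ∀ L, Fock (Orb (FermionTorus 2 L))),
      Tendsto Ls atTop atTop →
      (∀ j, IsGroundStateInSector (hubbardTorusTT' (Ls j) 1 p U') (rectN n (Ls j)) 0 (ψ (Ls j))) →
      (∀ j, star (ψ (Ls j)) ⬝ᵥ ψ (Ls j) = 1) → ω.IsTorusLimitOf ψ Ls →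
      valL₁ σ U' ≤ ((Finset.univ : Finset (DihedralGroup 4)).card : ℝ)⁻¹ * ∑ g ∈ (Finset.univ : Finset (DihedralGroup 4)),
        (ω.expect (d4ShiftSet g 0 (box 2 7)) (fermionEmbed (PolySite.d4Emb g 0 (box 2 7)) (-oddMomentObsTT σ U' 0))).re)
    (hcL₁ : ∀ σ ∈ Set.Icc p q, ∀ U' ∈ Set.Icc UA UL₁, -valL₁ σ U' ≤ ((c : ℚ) : ℝ))
    (hO : ∀ σ ∈ Set.Icc p q, ∀ s ∈ Set.Icc (p * (2 - UL₁ / UL₂)) p,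
      ∀ (ω : InfVolFermionState 2) (Ls : ℕ → ℕ) (ψ : ∀ L, Fock (Orb (FermionTorus 2 L))),
      Tendsto Ls atTop atTop →
      (∀ j, IsGroundStateInSector (hubbardTorusTT' (Ls j) 1 s UL₁) (rectN n (Ls j)) 0 (ψ (Ls j))) →
      (∀ j, star (ψ (Ls j)) ⬝ᵥ ψ (Ls j) = 1) → ω.IsTorusLimitOf ψ Ls →
      valO σ s ≤ ((Finset.univ : Finset (DihedralGroup 4)).card : ℝ)⁻¹ * ∑ g ∈ (Finset.univ : Finset (DihedralGroup 4)),
        (ω.expect (d4ShiftSet g 0 (box 2 7)) (fermionEmbed (PolySite.d4Emb g 0 (box 2 7)) (-oddMomentObsTT σ UL₁ 0))).re)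
    (hcO : ∀ σ ∈ Set.Icc p q, ∀ s ∈ Set.Icc (p * (2 - UL₁ / UL₂)) p, -valO σ s ≤ ((c : ℚ) : ℝ))
    (hL₂ : ∀ σ ∈ Set.Icc p q, ∀ U' ∈ Set.Icc UL₂ Umax,
      ∀ (ω : InfVolFermionState 2) (Ls : ℕ → ℕ) (ψ : ∀ L, Fock (Orb (FermionTorus 2 L))),
      Tendsto Ls atTop atTop →
      (∀ j, IsGroundStateInSector (hubbardTorusTT' (Ls j) 1 p U') (rectN n (Ls j)) 0 (ψ (Ls j))) →
      (∀ j, star (ψ (Ls j)) ⬝ᵥ ψ (Ls j) = 1) → ω.IsTorusLimitOf ψ Ls →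
      valL₂ σ U' ≤ ((Finset.univ : Finset (DihedralGroup 4)).card : ℝ)⁻¹ * ∑ g ∈ (Finset.univ : Finset (DihedralGroup 4)),
        (ω.expect (d4ShiftSet g 0 (box 2 7)) (fermionEmbed (PolySite.d4Emb g 0 (box 2 7)) (-oddMomentObsTT σ U' 0))).re)
    (hcL₂ : ∀ σ ∈ Set.Icc p q, ∀ U' ∈ Set.Icc UL₂ Umax, -valL₂ σ U' ≤ ((c : ℚ) : ℝ)) :
    ∀ tp ∈ Set.Icc p q, ∀ U ∈ Set.Icc UA Umax, tp * (2 * U - UA) / U ≤ p → ObsStiffnessSeqCeilingAt tp U n c := by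
  intro tp htp U hU hsA
  have hUP : 0 < U := hUA.trans_le hU.1
  have hUne : U ≠ 0 := hUP.ne'
  rcases hsA.lt_or_eq with hsA | hsA
  · have ht0 : tp < 0 := by
      rcases (htp.2.trans hq).eq_or_lt with h0 | h0
      · exfalso
        rw [h0, zero_mul, zero_div] at hsA
        exact absurd (htp.1.trans_eq h0) (not_le.2 hsA)
      · exact h0
    obtain ⟨hU'le, hapexL⟩ := leftEdge_apexSource htp.1 ht0 hUP
    have hU'gt : UA < U * (2 - p / tp) := (apexSource_lt_iff_station_lt_leftEdge ht0 hUP).1 hsA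
    by_cases h1 : U * (2 - p / tp) ≤ UL₁
    · -- (LEFT₁), slot `t′`
      have hmem : U * (2 - p / tp) ∈ Set.Icc UA UL₁ := ⟨hU'gt.le, h1⟩
      exact ObsStiffnessSeqCeilingAt_of_apexSource_targetSlot_orbitLower (U * (2 - p / tp)) (valL₁ tp (U * (2 - p / tp)))
        (hUA.le.trans hU'gt.le) hU'le hUP hapexL hn0 hn2 (hL₁ tp htp _ hmem) c (hcL₁ tp htp _ hmem)
    · have h1 : UL₁ < U * (2 - p / tp) := not_le.mp h1
      by_cases h2 : UL₂ ≤ U * (2 - p / tp)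
      · -- (LEFT₂), slot `t′`
        have hmem : U * (2 - p / tp) ∈ Set.Icc UL₂ Umax := ⟨h2, hU'le.trans hU.2⟩
        exact ObsStiffnessSeqCeilingAt_of_apexSource_targetSlot_orbitLower (U * (2 - p / tp)) (valL₂ tp (U * (2 - p / tp)))
          (hUA.le.trans hU'gt.le) hU'le hUP hapexL hn0 hn2 (hL₂ tp htp _ hmem) c (hcL₂ tp htp _ hmem)
      · -- (OVERHANG at `U_L₁`), slot `t′`
        have h2 : U * (2 - p / tp) < UL₂ := not_le.mp h2
        have hL1pos : 0 < UL₁ := hUA.trans_le hA1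
        have hL1U : UL₁ ≤ U := h1.le.trans hU'le
        have hs1lt : tp * (2 * U - UL₁) / U < p := (apexSource_lt_iff_station_lt_leftEdge ht0 hUP).2 h1
        have hs1ge : p * (2 - UL₁ / UL₂) ≤ tp * (2 * U - UL₁) / U := by
          rcases le_or_gt U UL₂ with hU2 | hU2
          · exact (apexSource_mem_Icc_of_slab (p := p) (UA := UL₁) (Umax := UL₂) hL1pos hL1U hU2 hq htp).1
          · by_contra hcon
            have hlt := leftEdge_height_gt_of_apexSource_lt_shortOverhang (p := p) ht0 hL1pos h12 hU2.le (not_le.mp hcon)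
            exact absurd h2 (not_lt.2 hlt.le)
        have hmem : tp * (2 * U - UL₁) / U ∈ Set.Icc (p * (2 - UL₁ / UL₂)) p := ⟨hs1ge, hs1lt.le⟩
        have hapexO : U * (tp * (2 * U - UL₁) / U) = (2 * U - UL₁) * tp := by
          rw [mul_div_assoc', mul_div_cancel_left₀ _ hUne]; ring
        exact ObsStiffnessSeqCeilingAt_of_apexSource_targetSlot_orbitLower UL₁ (valO tp (tp * (2 * U - UL₁) / U)) hL1pos.le hL1U hUP
          hapexO hn0 hn2 (hO tp htp _ hmem) c (hcO tp htp _ hmem)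
  · -- equality: the source IS the corner `(p, U_A)` — LEFT₁ at `U' = U_A`, slot `t′`
    have hapex : U * p = (2 * U - UA) * tp := by
      have e : tp * (2 * U - UA) = p * U := (div_eq_iff hUne).1 hsA
      linarith [e]
    exact ObsStiffnessSeqCeilingAt_of_apexSource_targetSlot_orbitLower UA (valL₁ tp UA) hUA.le hU.1 hUP hapex hn0 hn2
      (hL₁ tp htp UA ⟨le_rfl, hA1⟩) c (hcL₁ tp htp UA ⟨le_rfl, hA1⟩)

variable {UL : ℝ}

/-- **Transport-fan shadow of (E6) at ANY density: the SHORT overhang at the station + the TOP of the left edge, target-slot, nothing else.** Box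
`[p, q] × [U_A, U_max]`, `q ≤ 0 < U_A ≤ U_L`, `0 ≤ n < 2`: the overhang family on `[p(2 − U_A/U_L), p] × {U_A}` and the left-top family on `{p} × [U_L, U_max]`
(both for `−X₀(σ, ·)` at the target slot, `−val ≤ c`) give `ObsStiffnessSeqCeilingAt t′ U n c` at every box target with `t′(2U − U_A)/U ≤ p`; no lever, no `K₂` word,
no source left of `p(2 − U_A/U_L)`, no bottom family. [cite: KomaTasaki1994, §1] [cite: ScalapinoWhiteZhang1993, §II] -/
theorem ObsStiffnessSeqCeilingAt_transportShadow_of_shortOverhang_and_leftEdgeTop_targetSlot (hUA : 0 < UA) (hAL : UA ≤ UL) (hq : q ≤ 0)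
    (hn0 : 0 ≤ n) (hn2 : n < 2) (valO valL : ℝ → ℝ → ℝ) (c : ℚ)
    (hO : ∀ σ ∈ Set.Icc p q, ∀ s ∈ Set.Icc (p * (2 - UA / UL)) p,
      ∀ (ω : InfVolFermionState 2) (Ls : ℕ → ℕ) (ψ : ∀ L, Fock (Orb (FermionTorus 2 L))),
      Tendsto Ls atTop atTop →
      (∀ j, IsGroundStateInSector (hubbardTorusTT' (Ls j) 1 s UA) (rectN n (Ls j)) 0 (ψ (Ls j))) →
      (∀ j, star (ψ (Ls j)) ⬝ᵥ ψ (Ls j) = 1) → ω.IsTorusLimitOf ψ Ls →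
      valO σ s ≤ ((Finset.univ : Finset (DihedralGroup 4)).card : ℝ)⁻¹ * ∑ g ∈ (Finset.univ : Finset (DihedralGroup 4)),
        (ω.expect (d4ShiftSet g 0 (box 2 7)) (fermionEmbed (PolySite.d4Emb g 0 (box 2 7)) (-oddMomentObsTT σ UA 0))).re)
    (hcO : ∀ σ ∈ Set.Icc p q, ∀ s ∈ Set.Icc (p * (2 - UA / UL)) p, -valO σ s ≤ ((c : ℚ) : ℝ))
    (hL : ∀ σ ∈ Set.Icc p q, ∀ U' ∈ Set.Icc UL Umax,
      ∀ (ω : InfVolFermionState 2) (Ls : ℕ → ℕ) (ψ : ∀ L, Fock (Orb (FermionTorus 2 L))),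
      Tendsto Ls atTop atTop →
      (∀ j, IsGroundStateInSector (hubbardTorusTT' (Ls j) 1 p U') (rectN n (Ls j)) 0 (ψ (Ls j))) →
      (∀ j, star (ψ (Ls j)) ⬝ᵥ ψ (Ls j) = 1) → ω.IsTorusLimitOf ψ Ls →
      valL σ U' ≤ ((Finset.univ : Finset (DihedralGroup 4)).card : ℝ)⁻¹ * ∑ g ∈ (Finset.univ : Finset (DihedralGroup 4)),
        (ω.expect (d4ShiftSet g 0 (box 2 7)) (fermionEmbed (PolySite.d4Emb g 0 (box 2 7)) (-oddMomentObsTT σ U' 0))).re)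
    (hcL : ∀ σ ∈ Set.Icc p q, ∀ U' ∈ Set.Icc UL Umax, -valL σ U' ≤ ((c : ℚ) : ℝ)) :
    ∀ tp ∈ Set.Icc p q, ∀ U ∈ Set.Icc UA Umax, tp * (2 * U - UA) / U ≤ p → ObsStiffnessSeqCeilingAt tp U n c := by
  have hL0 : 0 < UL := hUA.trans_le hAL
  have hr : UA / UL ≤ 1 := (div_le_one hL0).2 hAL
  intro tp htp U hU hsA
  have hp0 : p ≤ 0 := htp.1.trans (htp.2.trans hq)
  have h1 : 0 ≤ (-p) * (1 - UA / UL) := mul_nonneg (by linarith) (by linarith)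
  have e1 : p * (2 - UA / UL) = p - (-p) * (1 - UA / UL) := by ring
  have hmemp : p ∈ Set.Icc (p * (2 - UA / UL)) p := ⟨by linarith [e1], le_rfl⟩
  refine ObsStiffnessSeqCeilingAt_transportShadow_of_twoWindowCurtain_targetSlot (UL₁ := UA) (UL₂ := UL) hUA le_rfl hAL hq hn0 hn2
    (fun σ _ => valO σ p) valO valL c (fun σ hσ U' hU' => ?_) (fun σ hσ U' hU' => hcO σ hσ p hmemp) hO hcO hL hcL tp htp U hU hsA
  have hU'A : U' = UA := le_antisymm hU'.2 hU'.1
  subst hU'A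
  exact hO σ hσ p hmemp

end Shadow

/-! ## «La214-E» doped (the M2(c) cell `n ∈ [171/200, 179/200]`): the transport-fan shadow of the station `29/5`, lever-free -/

section LaBoxEDoped

/-- **«La214-E» doped transport-fan shadow, any window height `U_L ≥ 29/5`, lever-free.** For every density `x ∈ [171/200, 179/200]` and slot
`σ ∈ [−3/10, −1/5]`: a short-overhang family `valO x σ s` on the classes at `(s, 29/5, x)`, `s ∈ [(−3/10)(2 − (29/5)/U_L), −3/10]`, and a left-top family
`valL x σ U'` on the classes at `(−3/10, U', x)`, `U' ∈ [U_L, 74/5]`, both for `−X₀(σ, ·)` with `−val ≤ c` ⇒ `ObsStiffnessSeqCeilingAt t′ U x c` at every target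
of `[−3/10, −1/5] × [29/5, 74/5] × [171/200, 179/200]` with `t′(2U − 29/5)/U ≤ −3/10`. [cite: KomaTasaki1994, §1] [cite: ScalapinoWhiteZhang1993, §II] -/
theorem ObsStiffnessSeqCeilingAt_on_laBoxE_doped_transportShadow_of_shortOverhang_and_leftEdgeTop (UL : ℝ) (hAL : 29 / 5 ≤ UL)
    (valO valL : ℝ → ℝ → ℝ → ℝ) (c : ℚ)
    (hO : ∀ x ∈ Set.Icc (171 / 200 : ℝ) (179 / 200), ∀ σ ∈ Set.Icc (-3 / 10 : ℝ) (-1 / 5),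
      ∀ s ∈ Set.Icc (-3 / 10 * (2 - 29 / 5 / UL) : ℝ) (-3 / 10),
      ∀ (ω : InfVolFermionState 2) (Ls : ℕ → ℕ) (ψ : ∀ L, Fock (Orb (FermionTorus 2 L))),
      Tendsto Ls atTop atTop →
      (∀ j, IsGroundStateInSector (hubbardTorusTT' (Ls j) 1 s (29 / 5)) (rectN x (Ls j)) 0 (ψ (Ls j))) →
      (∀ j, star (ψ (Ls j)) ⬝ᵥ ψ (Ls j) = 1) → ω.IsTorusLimitOf ψ Ls →
      valO x σ s ≤ ((Finset.univ : Finset (DihedralGroup 4)).card : ℝ)⁻¹ * ∑ g ∈ (Finset.univ : Finset (DihedralGroup 4)),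
        (ω.expect (d4ShiftSet g 0 (box 2 7)) (fermionEmbed (PolySite.d4Emb g 0 (box 2 7)) (-oddMomentObsTT σ (29 / 5) 0))).re)
    (hcO : ∀ x ∈ Set.Icc (171 / 200 : ℝ) (179 / 200), ∀ σ ∈ Set.Icc (-3 / 10 : ℝ) (-1 / 5),
      ∀ s ∈ Set.Icc (-3 / 10 * (2 - 29 / 5 / UL) : ℝ) (-3 / 10), -valO x σ s ≤ ((c : ℚ) : ℝ))
    (hL : ∀ x ∈ Set.Icc (171 / 200 : ℝ) (179 / 200), ∀ σ ∈ Set.Icc (-3 / 10 : ℝ) (-1 / 5), ∀ U' ∈ Set.Icc UL (74 / 5),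
      ∀ (ω : InfVolFermionState 2) (Ls : ℕ → ℕ) (ψ : ∀ L, Fock (Orb (FermionTorus 2 L))),
      Tendsto Ls atTop atTop →
      (∀ j, IsGroundStateInSector (hubbardTorusTT' (Ls j) 1 (-3 / 10) U') (rectN x (Ls j)) 0 (ψ (Ls j))) →
      (∀ j, star (ψ (Ls j)) ⬝ᵥ ψ (Ls j) = 1) → ω.IsTorusLimitOf ψ Ls →
      valL x σ U' ≤ ((Finset.univ : Finset (DihedralGroup 4)).card : ℝ)⁻¹ * ∑ g ∈ (Finset.univ : Finset (DihedralGroup 4)),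
        (ω.expect (d4ShiftSet g 0 (box 2 7)) (fermionEmbed (PolySite.d4Emb g 0 (box 2 7)) (-oddMomentObsTT σ U' 0))).re)
    (hcL : ∀ x ∈ Set.Icc (171 / 200 : ℝ) (179 / 200), ∀ σ ∈ Set.Icc (-3 / 10 : ℝ) (-1 / 5), ∀ U' ∈ Set.Icc UL (74 / 5),
      -valL x σ U' ≤ ((c : ℚ) : ℝ)) :
    ∀ tp ∈ Set.Icc (-3 / 10 : ℝ) (-1 / 5), ∀ U ∈ Set.Icc (29 / 5 : ℝ) (74 / 5), ∀ x ∈ Set.Icc (171 / 200 : ℝ) (179 / 200),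
      tp * (2 * U - 29 / 5) / U ≤ -3 / 10 → ObsStiffnessSeqCeilingAt tp U x c := by
  intro tp htp U hU x hx hs
  exact ObsStiffnessSeqCeilingAt_transportShadow_of_shortOverhang_and_leftEdgeTop_targetSlot (p := -3 / 10) (q := -1 / 5) (UA := 29 / 5)
    (UL := UL) (Umax := 74 / 5) (n := x) (by norm_num) hAL (by norm_num) (by linarith [hx.1]) (by linarith [hx.2]) (valO x) (valL x) c
    (hO x hx) (hcO x hx) (hL x hx) (hcL x hx) tp htp U hU hs

end LaBoxEDoped

end Summit.Ventures.CertifiedManyBodySolver.Observables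

end
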